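import Literature.NumberTheory.Transcendental.CijsouwWaldschmidt1977Liouville
import HarnessLib

/-!
# Cell abc-stewartyu, WP-A3 (i): the multiquadratic algebra `ℚ(√α₁, …, √αₖ)` inside an ARBITRARY
# field of characteristic zero (e.g. `ℚ_p`) — evaluation, multiplicativity, linear independence

`Summits/ABC/StewartYu/PadicMultiquadratic.lean` — cell `abc-stewartyu` (HOME
`run/shared/lean/pub/abc-stewartyu/`, seat p3, work package WP-A3 of `HOME/p2/PADIC-CORE.md`;
theorems and two plain definitions, no named fact).

The tree's Cijsouw–Waldschmidt 1977 development (`Literature.NumberTheory.Transcendental.CW77`,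
file `CijsouwWaldschmidt1977Liouville.lean`) expresses the values of the auxiliary functions at the
half points of Baker's `2`-descent on the monomials `∏_{j ∈ S} √αⱼ` of REAL square roots of positive
rationals, with coefficient vectors `c : Finset (Fin k) → ℚ`, the convolution product `CW77.cmul`,
and the evaluation `CW77.ev α c = ∑_S c_S ∏_{j∈S} √αⱼ ∈ ℝ`. For the `p`-adic port (blueprint
`PADIC-CORE.md` §3, dictionary row "values at points are algebraic") the square roots live in `ℚ_p`
(principal units `αⱼ ≡ 1 (mod p)` have `p`-adic square roots) and may be roots of NEGATIVE
rationals (the sign-normalised generators `α̃ⱼ` of WP-M), so positivity and `Real.sqrt` are not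
available. This file redoes the coefficient-vector algebra for an arbitrary field `L` of
characteristic zero and an arbitrary family of square roots `s : Fin k → L`, `sⱼ · sⱼ = αⱼ`:

* `monoL s S = ∏_{j∈S} sⱼ`, `evL s c = ∑_S c_S · monoL s S`; linearity; `evL_cmul`:
  `evL s (cmul α c d) = evL s c · evL s d` (from `monoL S · monoL T = (∏_{S∩T} αⱼ) · monoL (S Δ T)`);
* `finrank_adjoin_root_eq_two_pow`, `linearIndependent_monoL`: under the `2`-Kummer condition
  (no product of a non-empty subfamily of the `αⱼ` is a square in `ℚ`) the `2ᵏ` monomials are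
  `ℚ`-linearly independent in `L` — the tree's abstract `Literature.Barriers.ABC.Multiquadratic.
  finrank_adjoin_image_sqrt_and_sq` (any fields `K ⊆ L`, `char ≠ 2`) specialised to `K = ℚ`, with
  the given roots in place of `Real.sqrt`;
* `evL_ne_zero` (`c ≠ 0 ⇒ evL s c ≠ 0`), `evL_succ`, `evL_conjLast` (splitting off the last root).

The `p`-adic Liouville inequality built on this is in `PadicMultiquadraticLiouville.lean`.
Everything is [folklore]; nothing here is claimed to be in print.
-/

noncomputable section

open Finset IntermediateField
open Literature.NumberTheory.Transcendental.CW77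

namespace Summit.ABC.StewartYu

namespace Multiquad

variable {L : Type*} [Field L] [CharZero L]
variable {k : ℕ}

/-! ### Monomials and evaluation in a field of characteristic zero -/

/-- The monomial `∏_{j ∈ S} sⱼ` of a family of (square) roots `s : Fin k → L`. [folklore] -/
def monoL (s : Fin k → L) (S : Finset (Fin k)) : L := ∏ j ∈ S, s j

/-- Evaluation of a rational coefficient vector on the monomials: `∑_S c_S ∏_{j∈S} sⱼ`. [folklore] -/
def evL (s : Fin k → L) (c : Finset (Fin k) → ℚ) : L := ∑ S, (c S : L) * monoL s S

/-- `evL` is additive. [folklore] -/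
theorem evL_add (s : Fin k → L) (c d : Finset (Fin k) → ℚ) :
    evL s (c + d) = evL s c + evL s d := by
  unfold evL; rw [← Finset.sum_add_distrib]
  refine Finset.sum_congr rfl fun S _ => ?_
  simp only [Pi.add_apply, Rat.cast_add]; ring

/-- `evL` respects subtraction. [folklore] -/
theorem evL_sub (s : Fin k → L) (c d : Finset (Fin k) → ℚ) :
    evL s (c - d) = evL s c - evL s d := by
  unfold evL; rw [← Finset.sum_sub_distrib]
  refine Finset.sum_congr rfl fun S _ => ?_
  simp only [Pi.sub_apply, Rat.cast_sub]; ring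

/-- `evL` is `ℚ`-homogeneous. [folklore] -/
theorem evL_smul (s : Fin k → L) (q : ℚ) (c : Finset (Fin k) → ℚ) :
    evL s (q • c) = (q : L) * evL s c := by
  unfold evL; rw [Finset.mul_sum]
  refine Finset.sum_congr rfl fun S _ => ?_
  simp only [Pi.smul_apply, smul_eq_mul, Rat.cast_mul]; ring

omit [CharZero L] in
/-- `evL s 0 = 0`. [folklore] -/
theorem evL_zero (s : Fin k → L) : evL s 0 = 0 := by
  unfold evL; simp

/-- `evL s (-c) = -evL s c`. [folklore] -/
theorem evL_neg (s : Fin k → L) (c : Finset (Fin k) → ℚ) : evL s (-c) = -evL s c := by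
  have h := evL_sub s 0 c
  rw [zero_sub, evL_zero, zero_sub] at h
  exact h

/-- Products of root monomials: `(∏_S sⱼ)(∏_T sⱼ) = (∏_{S∩T} αⱼ) · ∏_{S Δ T} sⱼ` when `sⱼ² = αⱼ`.
[folklore] -/
theorem monoL_mul_monoL (α : Fin k → ℚ) (s : Fin k → L) (hs : ∀ j, s j * s j = (α j : L))
    (S T : Finset (Fin k)) :
    monoL s S * monoL s T = ((∏ j ∈ S ∩ T, α j : ℚ) : L) * monoL s (symmDiff S T) := by
  classical
  unfold monoL
  have hS : ∏ j ∈ S, s j = (∏ j ∈ S \ T, s j) * ∏ j ∈ S ∩ T, s j := by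
    rw [← Finset.prod_union (Finset.disjoint_sdiff_inter S T), Finset.sdiff_union_inter]
  have hT : ∏ j ∈ T, s j = (∏ j ∈ T \ S, s j) * ∏ j ∈ S ∩ T, s j := by
    rw [Finset.inter_comm, ← Finset.prod_union (Finset.disjoint_sdiff_inter T S),
      Finset.sdiff_union_inter]
  have hsq : (∏ j ∈ S ∩ T, s j) * (∏ j ∈ S ∩ T, s j) = ((∏ j ∈ S ∩ T, α j : ℚ) : L) := by
    rw [← Finset.prod_mul_distrib, Rat.cast_prod]
    exact Finset.prod_congr rfl fun j _ => hs j
  have hΔ : ∏ j ∈ symmDiff S T, s j = (∏ j ∈ S \ T, s j) * ∏ j ∈ T \ S, s j := by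
    rw [symmDiff_def, Finset.sup_eq_union, Finset.prod_union disjoint_sdiff_sdiff]
  rw [hS, hT, hΔ, ← hsq]; ring

/-- **`evL` is multiplicative for the convolution product `CW77.cmul`.** [folklore] -/
theorem evL_cmul (α : Fin k → ℚ) (s : Fin k → L) (hs : ∀ j, s j * s j = (α j : L))
    (c d : Finset (Fin k) → ℚ) :
    evL s (cmul α c d) = evL s c * evL s d := by
  classical
  unfold evL cmul
  rw [Finset.sum_mul_sum]
  have lhs : ∑ U, ((∑ S, ∑ T, (if symmDiff S T = U then (∏ j ∈ S ∩ T, α j) * (c S * d T) else 0)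
      : ℚ) : L) * monoL s U =
      ∑ S, ∑ T, ((∏ j ∈ S ∩ T, α j : ℚ) : L) * ((c S : L) * (d T : L)) * monoL s (symmDiff S T) := by
    simp only [Rat.cast_sum, Finset.sum_mul]
    rw [Finset.sum_comm]
    refine Finset.sum_congr rfl fun S _ => ?_
    rw [Finset.sum_comm]
    refine Finset.sum_congr rfl fun T _ => ?_
    rw [Finset.sum_eq_single (symmDiff S T)]
    · simp
    · intro U _ hU; rw [if_neg (Ne.symm hU)]; simp
    · intro h; exact absurd (Finset.mem_univ _) h
  rw [lhs]
  refine Finset.sum_congr rfl fun S _ => Finset.sum_congr rfl fun T _ => ?_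
  have key := monoL_mul_monoL α s hs S T
  calc ((∏ j ∈ S ∩ T, α j : ℚ) : L) * ((c S : L) * (d T : L)) * monoL s (symmDiff S T)
      = ((c S : L) * (d T : L)) * (((∏ j ∈ S ∩ T, α j : ℚ) : L) * monoL s (symmDiff S T)) := by
        ring
    _ = ((c S : L) * (d T : L)) * (monoL s S * monoL s T) := by rw [key]
    _ = (c S : L) * monoL s S * ((d T : L) * monoL s T) := by ring

/-! ### Linear independence of the monomials under the `2`-Kummer condition -/

/-- **`[ℚ(s₀, …, s_{n-1}) : ℚ] = 2ⁿ`** for roots `sⱼ ∈ L`, `sⱼ² = αⱼ ∈ ℚ`, when no product of a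
non-empty subfamily of the `αⱼ` is a square in `ℚ` — in ANY field `L` of characteristic zero
(the tree's `Multiquadratic.finrank_adjoin_image_sqrt_and_sq` specialised to `K = ℚ`). [folklore] -/
theorem finrank_adjoin_root_eq_two_pow {n : ℕ} (α : Fin n → ℚ)
    (hind : ∀ T : Finset (Fin n), T.Nonempty → ¬ IsSquare (∏ j ∈ T, α j))
    (s : Fin n → L) (hs : ∀ j, s j * s j = (α j : L)) :
    Module.finrank ℚ ↥(IntermediateField.adjoin ℚ (Set.range s)) = 2 ^ n := by
  classical
  set c : ℕ → ℚ := fun i => if h : i < n then α ⟨i, h⟩ else 0 with hc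
  set y : ℕ → L := fun i => if h : i < n then s ⟨i, h⟩ else 0 with hy
  have hyc : ∀ i, algebraMap ℚ L (c i) = y i * y i := by
    intro i
    rw [eq_ratCast]
    simp only [hc, hy]
    split_ifs with h
    · exact (hs _).symm
    · simp
  have hrange : Set.range s = (y '' {i | i < n}) := by
    ext z
    simp only [Set.mem_range, Set.mem_image, Set.mem_setOf_eq]
    constructor
    · rintro ⟨j, rfl⟩
      refine ⟨j, j.2, ?_⟩
      simp [hy, j.2]
    · rintro ⟨i, hi, rfl⟩
      refine ⟨⟨i, hi⟩, ?_⟩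
      simp [hy, hi]
  have hind' : ∀ T : Finset ℕ, (∀ i ∈ T, i < n) → T.Nonempty → ¬ IsSquare (∏ i ∈ T, c i) := by
    intro T hT hTne hsq
    set T' : Finset (Fin n) := Finset.univ.filter fun j => (j : ℕ) ∈ T with hT'
    have hmap : T'.map Fin.valEmbedding = T := by
      ext i
      simp only [Finset.mem_map, Finset.mem_filter, Finset.mem_univ, true_and,
        Fin.valEmbedding_apply, hT']
      constructor
      · rintro ⟨j, hj, rfl⟩; exact hj
      · intro hi; exact ⟨⟨i, hT i hi⟩, hi, rfl⟩
    have hprod : ∏ i ∈ T, c i = ∏ j ∈ T', α j := by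
      rw [← hmap, Finset.prod_map]
      refine Finset.prod_congr rfl fun j _ => ?_
      simp [hc, j.2]
    have hT'ne : T'.Nonempty := by
      obtain ⟨i, hi⟩ := hTne
      exact ⟨⟨i, hT i hi⟩, by simp [hT', hi]⟩
    exact hind T' hT'ne (hprod ▸ hsq)
  rw [hrange]
  exact (Literature.Barriers.ABC.Multiquadratic.finrank_adjoin_image_sqrt_and_sq two_ne_zero y c
    hyc n hind' n le_rfl).1

/-- **The root monomials are `ℚ`-linearly independent in `L`** under the `2`-Kummer condition
(their `ℚ`-span is a subalgebra containing the roots, hence the field `ℚ(s₀, …, s_{n-1})` of degree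
`2ⁿ`). [folklore] -/
theorem linearIndependent_monoL {n : ℕ} (α : Fin n → ℚ)
    (hind : ∀ T : Finset (Fin n), T.Nonempty → ¬ IsSquare (∏ j ∈ T, α j))
    (s : Fin n → L) (hs : ∀ j, s j * s j = (α j : L)) :
    LinearIndependent ℚ (fun S : Finset (Fin n) => monoL s S) := by
  classical
  set v : Finset (Fin n) → L := fun S => monoL s S with hv
  set E : IntermediateField ℚ L := IntermediateField.adjoin ℚ (Set.range s) with hE
  have hfin : Module.finrank ℚ ↥E = 2 ^ n := finrank_adjoin_root_eq_two_pow α hind s hs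
  set V : Submodule ℚ L := Submodule.span ℚ (Set.range v) with hV
  have hVmul : ∀ x y, x ∈ V → y ∈ V → x * y ∈ V := by
    intro x y hx hy
    have hxy : x * y ∈ V * V := Submodule.mul_mem_mul hx hy
    rw [hV, Submodule.span_mul_span] at hxy
    refine (Submodule.span_le.mpr ?_) hxy
    rintro _ ⟨a, ⟨S, rfl⟩, b, ⟨T, rfl⟩, rfl⟩
    show v S * v T ∈ Submodule.span ℚ (Set.range v)
    have hprod : v S * v T = (∏ j ∈ S ∩ T, α j : ℚ) • v (symmDiff S T) := by
      rw [Rat.smul_def]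
      exact monoL_mul_monoL α s hs S T
    rw [hprod]
    exact Submodule.smul_mem _ _ (Submodule.subset_span ⟨symmDiff S T, rfl⟩)
  have h1 : (1 : L) ∈ V := Submodule.subset_span ⟨∅, by simp [hv, monoL]⟩
  set A : Subalgebra ℚ L := V.toSubalgebra h1 hVmul with hA
  have halg : ∀ x ∈ Set.range s, IsAlgebraic ℚ x := by
    rintro _ ⟨j, rfl⟩
    have hint : IsIntegral ℚ (s j ^ 2) := by
      have : s j ^ 2 = algebraMap ℚ L (α j) := by rw [sq, hs j, eq_ratCast]
      rw [this]; exact isIntegral_algebraMap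
    exact (hint.of_pow two_pos).isAlgebraic
  have hEA : E.toSubalgebra ≤ A := by
    rw [hE, IntermediateField.adjoin_toSubalgebra_of_isAlgebraic halg]
    refine Algebra.adjoin_le ?_
    rintro _ ⟨j, rfl⟩
    show s j ∈ V
    exact Submodule.subset_span ⟨{j}, by simp [hv, monoL]⟩
  have hVE : V = Subalgebra.toSubmodule E.toSubalgebra := by
    apply le_antisymm
    · rw [hV, Submodule.span_le]
      rintro _ ⟨S, rfl⟩
      show v S ∈ E
      exact prod_mem fun j _ => IntermediateField.subset_adjoin ℚ _ ⟨j, rfl⟩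
    · intro x hx; exact hEA hx
  rw [linearIndependent_iff_card_eq_finrank_span, Fintype.card_finset, Fintype.card_fin]
  show 2 ^ n = Module.finrank ℚ ↥(Submodule.span ℚ (Set.range v))
  rw [← hV, hVE, Subalgebra.finrank_toSubmodule]
  exact hfin.symm

/-- **A non-zero coefficient vector has a non-zero evaluation** (under the `2`-Kummer condition).
[folklore] -/
theorem evL_ne_zero (α : Fin k → ℚ)
    (hind : ∀ T : Finset (Fin k), T.Nonempty → ¬ IsSquare (∏ j ∈ T, α j))
    (s : Fin k → L) (hs : ∀ j, s j * s j = (α j : L))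
    {c : Finset (Fin k) → ℚ} (hc : c ≠ 0) : evL s c ≠ 0 := by
  intro h0
  apply hc
  have hli := linearIndependent_monoL α hind s hs
  rw [linearIndependent_iff'] at hli
  have h0' : ∑ S ∈ (univ : Finset (Finset (Fin k))), c S • monoL s S = 0 := by
    rw [← h0]; unfold evL
    refine Finset.sum_congr rfl fun S _ => ?_
    rw [Rat.smul_def]
  funext S
  exact hli univ c h0' S (Finset.mem_univ S)

/-! ### Splitting off the last root -/

variable (s' : Fin (k + 1) → L)

/-- The first `k` roots. [folklore] -/
abbrev initL : Fin k → L := fun j => s' (Fin.castSucc j)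

omit [CharZero L] in
/-- Monomials without the last root. [folklore] -/
theorem monoL_map (S : Finset (Fin k)) : monoL s' (S.map Fin.castSuccEmb) = monoL (initL s') S := by
  unfold monoL initL
  rw [Finset.prod_map]
  rfl

omit [CharZero L] in
/-- Monomials with the last root: `monoL (insert last S) = s_k · monoL S`. [folklore] -/
theorem monoL_insert (S : Finset (Fin k)) :
    monoL s' (insert (Fin.last k) (S.map Fin.castSuccEmb)) = s' (Fin.last k) * monoL (initL s') S := by
  rw [← monoL_map s' S]
  unfold monoL
  rw [Finset.prod_insert (last_not_mem_map S)]

omit [CharZero L] in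
/-- **`evL s' c = evL s (lo c) + s_k · evL s (hi c)`.** [folklore] -/
theorem evL_succ (c : Finset (Fin (k + 1)) → ℚ) :
    evL s' c = evL (initL s') (lo c) + s' (Fin.last k) * evL (initL s') (hi c) := by
  unfold evL
  rw [sum_finset_succ, Finset.mul_sum]
  congr 1
  · refine Finset.sum_congr rfl fun S _ => ?_
    rw [monoL_map]; rfl
  · refine Finset.sum_congr rfl fun S _ => ?_
    rw [monoL_insert]; unfold hi; ring

/-- `evL s' (conjLast c) = evL s (lo c) − s_k · evL s (hi c)`. [folklore] -/
theorem evL_conjLast (c : Finset (Fin (k + 1)) → ℚ) :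
    evL s' (conjLast c) = evL (initL s') (lo c) - s' (Fin.last k) * evL (initL s') (hi c) := by
  rw [evL_succ, lo_conjLast, hi_conjLast, evL_neg]; ring

omit [CharZero L] in
/-- The roots of the first `k` generators square to the first `k` generators. [folklore] -/
theorem initL_sq (α' : Fin (k + 1) → ℚ) (hs : ∀ j, s' j * s' j = (α' j : L)) (j : Fin k) :
    initL s' j * initL s' j = (init α' j : L) := hs _

end Multiquad

end Summit.ABC.StewartYu

end
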